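import Summits.AtomisticToContinuum.BoseEinsteinCondensation.Theorems.FibreConductance.Negative.SlabState

/-!
# Crux `FibreConductance` — the test function and the pairing bounds

The test function `η = f(x₀₀) ∏_{j≠0} φ(xⱼ)²` (chamber selector times the bath density):
admissible (`C¹`, periodic); `Σₗ|∂_{0,l}η|² = bathProd² f'(x₀₀)²`; the pointwise and integrated
dual bounds `Σₗ|∂η|²ψ²/W ≤ bathProd·(4πK/L)²σ²/Z`, `∫ … ≤ 64π²K²σ²/L²` (`lintegral_dual_le`);
the pairing `∫ q η = L^{-3/2} L² ∫₀ᴸ e^{iθ}Gf` (`pairing_eq`) and its lower bound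
`‖∫ q η‖ ≥ 1/16` (`norm_pairing_ge`: the chamber charge cannot be neutralised without crossing a
barrier).

Crux disprover file for `stmt-AtomisticToContinuum-9480` (route `BECThomsonPrinciple`, crux
`FibreConductance`); part of the chain `Profiles → OneDimAxis → (FibreVocabulary) → SlabState →
TestFunction → NearMinimiserFalse` proving `not_fibreConductanceNearMinimiser`: the exact-minimiser
hypothesis (H1) of the crux cannot be relaxed to `δ`-near-minimality for any `δ > 0`.
All [folklore] (elementary real analysis).
-/

noncomputable section

namespace Summit.AtomisticToContinuum.BoseEinsteinCondensation.Theorems.FibreConductance.Negative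

open MeasureTheory Literature.MathematicalPhysics.QuantumManyBody.BoseGas
open scoped ENNReal NNReal

/-! ### The test function and the refutation -/

section Main

open Real intervalIntegral
open Summit.AtomisticToContinuum.BoseEinsteinCondensation.Theorems.GaussianDominationCan.Negative

variable {m : ℕ} {L σ : ℝ}

/-- The factors of the test function `η(X) = f(x₀₀) ∏_{j≠0} φ(xⱼ)²`. [folklore] -/
def etaFactors (m : ℕ) (L σ : ℝ) : Fin (m + 1) → Space → ℂ := fun j =>
  if j = 0 then axisFun (testProfile L) else axisFun fun t => slabG L σ t ^ 2

/-- The test function `η = f(x₀₀) ∏_{j≠0} φ(xⱼ)²` (chamber selector times the bath density). [folklore] -/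
def eta (m : ℕ) (L σ : ℝ) : Config (m + 1) → ℂ := prodFun (etaFactors m L σ)

/-- The `0`-th factor of `η` is the chamber selector `f(y₀)`. [folklore] -/
theorem etaFactors_zero : etaFactors m L σ 0 = axisFun (testProfile L) := by
  simp [etaFactors]

/-- The bath factors of `η` are `φ² = G(y₀)²`. [folklore] -/
theorem etaFactors_of_ne {j : Fin (m + 1)} (hj : j ≠ 0) :
    etaFactors m L σ j = axisFun fun t => slabG L σ t ^ 2 := by
  simp [etaFactors, hj]

/-- The bath factors of `η`, evaluated. [folklore] -/
theorem etaFactors_of_ne_apply {j : Fin (m + 1)} (hj : j ≠ 0) (y : Space) :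
    etaFactors m L σ j y = (((slabFactor L σ y) ^ 2 : ℝ) : ℂ) := by
  rw [etaFactors_of_ne hj]; rfl

/-- Every factor of `η` is `C¹`. [folklore] -/
theorem contDiff_etaFactors (j : Fin (m + 1)) : ContDiff ℝ 1 (etaFactors m L σ j) := by
  by_cases hj : j = 0
  · subst hj; rw [etaFactors_zero]; exact contDiff_axisFun (contDiff_testProfile L)
  · rw [etaFactors_of_ne hj]; exact contDiff_axisFun ((contDiff_slabG L σ).pow 2)

/-- Every factor of `η` is differentiable. [folklore] -/
theorem differentiable_etaFactors (j : Fin (m + 1)) : Differentiable ℝ (etaFactors m L σ j) :=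
  (contDiff_etaFactors j).differentiable one_ne_zero

/-- Every factor of `η` is continuous. [folklore] -/
theorem continuous_etaFactors (j : Fin (m + 1)) : Continuous (etaFactors m L σ j) :=
  (contDiff_etaFactors j).continuous

/-- Every factor of `η` is `Lℤ³`-periodic. [folklore] -/
theorem etaFactors_periodic (hL : L ≠ 0) (j : Fin (m + 1)) (y : Space) (k : Fin 3) :
    etaFactors m L σ j (y + EuclideanSpace.single k L) = etaFactors m L σ j y := by
  by_cases hj : j = 0
  · subst hj; rw [etaFactors_zero]; exact axisFun_periodic (testProfile_add_period hL) y k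
  · rw [etaFactors_of_ne hj]
    exact axisFun_periodic (G := fun t => slabG L σ t ^ 2) (fun t => by simp only [slabG_add_period hL]) y k

/-- `η` is `C¹`. [folklore] -/
theorem contDiff_eta : ContDiff ℝ 1 (eta m L σ) := contDiff_prodFun contDiff_etaFactors

/-- `η` is `Lℤ³`-periodic in every particle (an admissible test function). [folklore] -/
theorem eta_periodic (hL : L ≠ 0) (X : Config (m + 1)) (i : Fin (m + 1)) (k : Fin 3) :
    eta m L σ (X + Pi.single i (EuclideanSpace.single k L)) = eta m L σ X :=
  prodFun_periodic (fun j y k => etaFactors_periodic hL j y k) X i k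

/-- The bath part of `η`: `∏_{j≠0} η_j(xⱼ) = bathProd φ X` (as a complex number). [folklore] -/
theorem prod_erase_etaFactors (X : Config (m + 1)) :
    ∏ j ∈ Finset.univ.erase (0 : Fin (m + 1)), etaFactors m L σ j (X j) =
      ((bathProd (slabFactor L σ) X : ℝ) : ℂ) := by
  unfold bathProd
  push_cast
  refine Finset.prod_congr rfl fun j hj => ?_
  rw [etaFactors_of_ne_apply (Finset.ne_of_mem_erase hj)]
  push_cast
  ring

/-- **The dual energy density of `η`**: `Σₗ |∂_{0,l} η|² = bathProd² · f'(x₀₀)²`. [folklore] -/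
theorem sum_norm_sq_fderiv_eta (X : Config (m + 1)) :
    ∑ l : Fin 3, ‖fderiv ℝ (eta m L σ) X (Pi.single 0 (EuclideanSpace.single l (1 : ℝ)))‖ ^ 2 =
      bathProd (slabFactor L σ) X ^ 2 * deriv (testProfile L) ((X 0) 0) ^ 2 := by
  unfold eta
  simp_rw [fderiv_prodFun differentiable_etaFactors X 0, norm_mul, mul_pow, prod_erase_etaFactors,
    Complex.norm_real, Real.norm_eq_abs, sq_abs]
  rw [← Finset.mul_sum, etaFactors_zero,
    sum_norm_sq_fderiv_axisFun ((contDiff_testProfile L).differentiable one_ne_zero)]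

/-- **Pointwise dual bound**: `Σₗ|∂_{0,l}η|² / (W/ψ²) ≤ bathProd · (4πK/L)²σ²/Z`. [folklore] -/
theorem dual_density_le (hL : 0 < L) (hσ0 : 0 < σ) (hσ1 : σ ≤ 1) {K : ℝ}
    (hK : ∀ x, |deriv smoothTransition x| ≤ K) (X : Config (m + 1)) :
    (∑ l : Fin 3, ‖fderiv ℝ (eta m L σ) X (Pi.single 0 (EuclideanSpace.single l (1 : ℝ)))‖ ^ 2) /
        (bathProd (slabFactor L σ) X / slabFactor L σ (X 0) ^ 2) ≤
      bathProd (slabFactor L σ) X * ((4 * π * K / L) ^ 2 * σ ^ 2 / slabZ L σ) := by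
  have hB := bathProd_pos (slabFactor_pos hL hσ0 hσ1) X
  have hφ := slabFactor_pos hL hσ0 hσ1 (X 0)
  have hZ := slabZ_pos hL hσ0.le hσ1
  rw [sum_norm_sq_fderiv_eta, div_div_eq_mul_div, div_le_iff₀ hB]
  have key : deriv (testProfile L) ((X 0) 0) ^ 2 * slabFactor L σ (X 0) ^ 2 ≤
      (4 * π * K / L) ^ 2 * σ ^ 2 / slabZ L σ := by
    have h := deriv_testProfile_sq_mul_slabProfile_sq_le (σ := σ) hL hK ((X 0) 0)
    unfold slabFactor slabG
    rw [div_pow, Real.sq_sqrt hZ.le, ← mul_div_assoc, div_le_div_iff_of_pos_right hZ]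
    exact h
  calc bathProd (slabFactor L σ) X ^ 2 * deriv (testProfile L) ((X 0) 0) ^ 2 * slabFactor L σ (X 0) ^ 2
      = (bathProd (slabFactor L σ) X * bathProd (slabFactor L σ) X) *
          (deriv (testProfile L) ((X 0) 0) ^ 2 * slabFactor L σ (X 0) ^ 2) := by ring
    _ ≤ (bathProd (slabFactor L σ) X * bathProd (slabFactor L σ) X) *
          ((4 * π * K / L) ^ 2 * σ ^ 2 / slabZ L σ) := by gcongr
    _ = bathProd (slabFactor L σ) X * ((4 * π * K / L) ^ 2 * σ ^ 2 / slabZ L σ) *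
          bathProd (slabFactor L σ) X := by ring

/-- `bathProd` in `ℝ≥0∞`: `ofReal (∏ φ²) = ∏ ofReal φ²`. [folklore] -/
theorem ofReal_bathProd (X : Config (m + 1)) :
    ENNReal.ofReal (bathProd (slabFactor L σ) X) =
      ∏ j ∈ Finset.univ.erase (0 : Fin (m + 1)), ENNReal.ofReal (slabFactor L σ (X j) ^ 2) := by
  unfold bathProd
  rw [ENNReal.ofReal_prod_of_nonneg fun j _ => sq_nonneg _]

/-- **The dual energy of `η` is small**: `∫ Σₗ|∂_{0,l}η|² ψ²/W ≤ 64π²K²σ²/L²`. [folklore] -/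
theorem lintegral_dual_le (hL : 0 < L) (hσ0 : 0 < σ) (hσ1 : σ ≤ 1) {K : ℝ}
    (hK : ∀ x, |deriv smoothTransition x| ≤ K) :
    ∫⁻ X in cellN (m + 1) L, ENNReal.ofReal
      ((∑ l : Fin 3, ‖fderiv ℝ (eta m L σ) X (Pi.single 0 (EuclideanSpace.single l (1 : ℝ)))‖ ^ 2) /
        (bathProd (slabFactor L σ) X / slabFactor L σ (X 0) ^ 2)) ≤
      ENNReal.ofReal (64 * π ^ 2 * K ^ 2 * σ ^ 2 / L ^ 2) := by
  have hZ := slabZ_pos hL hσ0.le hσ1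
  have hZb := (slabZ_bounds hL hσ0.le hσ1).1
  set c₁ : ℝ := (4 * π * K / L) ^ 2 * σ ^ 2 / slabZ L σ with hc₁
  have hc₁0 : 0 ≤ c₁ := by positivity
  have hF : Measurable fun y : Space => ENNReal.ofReal (slabFactor L σ y ^ 2) :=
    ((continuous_slabFactor L σ).pow 2).measurable.ennreal_ofReal
  calc ∫⁻ X in cellN (m + 1) L, ENNReal.ofReal
        ((∑ l : Fin 3, ‖fderiv ℝ (eta m L σ) X (Pi.single 0 (EuclideanSpace.single l (1 : ℝ)))‖ ^ 2) /
          (bathProd (slabFactor L σ) X / slabFactor L σ (X 0) ^ 2))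
      ≤ ∫⁻ X in cellN (m + 1) L, ENNReal.ofReal (bathProd (slabFactor L σ) X * c₁) :=
        lintegral_mono fun X => ENNReal.ofReal_le_ofReal (dual_density_le hL hσ0 hσ1 hK X)
    _ = ∫⁻ X in cellN (m + 1) L,
          (∏ j ∈ Finset.univ.erase (0 : Fin (m + 1)), ENNReal.ofReal (slabFactor L σ (X j) ^ 2)) *
            ENNReal.ofReal c₁ := by
        refine lintegral_congr fun X => ?_
        rw [ENNReal.ofReal_mul (bathProd_pos (slabFactor_pos hL hσ0 hσ1) X).le, ofReal_bathProd]
    _ = ENNReal.ofReal L ^ 3 * ENNReal.ofReal c₁ := by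
        rw [lintegral_mul_const' _ _ ENNReal.ofReal_ne_top, lintegral_prod_erase 0 hF]
        simp only [lintegral_ofReal_sq_slabFactor hL hσ0.le hσ1, Finset.prod_const_one, mul_one]
    _ = ENNReal.ofReal (L ^ 3 * c₁) := by
        rw [← ENNReal.ofReal_pow hL.le, ← ENNReal.ofReal_mul (by positivity)]
    _ ≤ ENNReal.ofReal (64 * π ^ 2 * K ^ 2 * σ ^ 2 / L ^ 2) := by
        apply ENNReal.ofReal_le_ofReal
        rw [hc₁]
        have h3 : 1 / slabZ L σ ≤ 4 / L ^ 3 := by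
          rw [div_le_div_iff₀ hZ (by positivity)]; linarith
        calc L ^ 3 * ((4 * π * K / L) ^ 2 * σ ^ 2 / slabZ L σ)
            = L ^ 3 * ((4 * π * K / L) ^ 2 * σ ^ 2) * (1 / slabZ L σ) := by ring
          _ ≤ L ^ 3 * ((4 * π * K / L) ^ 2 * σ ^ 2) * (4 / L ^ 3) := by gcongr
          _ = 64 * π ^ 2 * K ^ 2 * σ ^ 2 / L ^ 2 := by field_simp; ring

/-- The one-dimensional pairing integrand `e^{iθ} G f`. [folklore] -/
def pairingFun (L σ t : ℝ) : ℂ :=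
  Complex.exp ((ang L t : ℂ) * Complex.I) * ((slabG L σ t * testProfile L t : ℝ) : ℂ)

/-- The pairing integrand is continuous. [folklore] -/
theorem continuous_pairingFun (L σ : ℝ) : Continuous (pairingFun L σ) := by
  unfold pairingFun
  have h1 := (contDiff_ang L).continuous
  have h2 := (contDiff_slabG L σ).continuous
  have h3 := (contDiff_testProfile L).continuous
  fun_prop

/-- `Im(e^{iθ} G f) = sin θ · G f`. [folklore] -/
theorem im_pairingFun (L σ t : ℝ) :
    (pairingFun L σ t).im = sin (ang L t) * (slabG L σ t * testProfile L t) := by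
  unfold pairingFun
  rw [Complex.im_mul_ofReal, Complex.exp_ofReal_mul_I_im]

/-- **The chamber charge seen by `η`**: `‖∫₀ᴸ e^{iθ} G f‖ ≥ (L/16)/√Z`. [folklore] -/
theorem norm_intervalIntegral_pairingFun_ge (hL : 0 < L) (hσ0 : 0 < σ) (hσ : σ ≤ 1 / 3) :
    L / 16 / Real.sqrt (slabZ L σ) ≤ ‖∫ t in (0 : ℝ)..L, pairingFun L σ t‖ := by
  have hσ1 : σ ≤ 1 := hσ.trans (by norm_num)
  have hZ := slabZ_pos hL hσ0.le hσ1
  have hint : IntervalIntegrable (pairingFun L σ) volume 0 L :=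
    (continuous_pairingFun L σ).intervalIntegrable 0 L
  have him : (∫ t in (0 : ℝ)..L, pairingFun L σ t).im =
      ∫ t in (0 : ℝ)..L, sin (ang L t) * slabProfile L σ t * testProfile L t / Real.sqrt (slabZ L σ) := by
    have h := (Complex.imCLM.intervalIntegral_comp_comm hint).symm
    simp only [Complex.imCLM_apply] at h
    rw [h]
    refine intervalIntegral.integral_congr fun t _ => ?_
    simp only [im_pairingFun, slabG]
    ring
  rw [intervalIntegral.integral_div] at him
  have hlow := intervalIntegral_sin_mul_profiles_ge hL hσ0.le hσ
  calc L / 16 / Real.sqrt (slabZ L σ)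
      ≤ (∫ t in (0 : ℝ)..L, sin (ang L t) * slabProfile L σ t * testProfile L t) / Real.sqrt (slabZ L σ) := by
        gcongr
    _ = (∫ t in (0 : ℝ)..L, pairingFun L σ t).im := him.symm
    _ ≤ ‖∫ t in (0 : ℝ)..L, pairingFun L σ t‖ := Complex.im_le_norm _

/-- **The pairing of the slab charge with `η`**:
`∫ q η = L^{-3/2} · L² · ∫₀ᴸ e^{iθ} G f`. [folklore] -/
theorem pairing_eq (hL : 0 < L) (hσ0 : 0 < σ) (hσ1 : σ ≤ 1) :
    ∫ X in cellN (m + 1) L, fibreCharge L e0 (realProd m (slabFactor L σ)) X * eta m L σ X =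
      ((Real.sqrt (L ^ 3))⁻¹ : ℂ) * (((L : ℂ) ^ 2) * ∫ t in (0 : ℝ)..L, pairingFun L σ t) := by
  set F := etaFactors m L σ with hF
  set h : Space → ℂ := fun y => wave L e0 y * ((slabFactor L σ y : ℝ) : ℂ) * F 0 y with hh
  have hpt : ∀ X : Config (m + 1),
      fibreCharge L e0 (realProd m (slabFactor L σ)) X * eta m L σ X =
        ((Real.sqrt (L ^ 3))⁻¹ : ℂ) * prodFun (Function.update F 0 h) X := by
    intro X
    rw [fibreCharge_slabState hL hσ0 hσ1, eta, prodFun_update_fun, ← hF, prodFun_eq_mul_erase F 0 X, hh]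
    ring
  simp_rw [hpt]
  rw [MeasureTheory.integral_const_mul]
  congr 1
  -- product integral
  have hprod : ∫ X in cellN (m + 1) L, prodFun (Function.update F 0 h) X =
      ∏ j, ∫ y in cell L, Function.update F 0 h j y := integral_cellN_prod _
  have hupd : ∀ j, (∫ y in cell L, Function.update F 0 h j y) =
      Function.update (fun j => ∫ y in cell L, F j y) 0 (∫ y in cell L, h y) j := fun j =>
    Function.apply_update (fun _ (g : Space → ℂ) => ∫ y in cell L, g y) F 0 h j
  rw [hprod]
  simp_rw [hupd]
  rw [Finset.prod_update_of_mem (Finset.mem_univ _), Finset.sdiff_singleton_eq_erase]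
  have hones : ∀ j ∈ Finset.univ.erase (0 : Fin (m + 1)), ∫ y in cell L, F j y = 1 := by
    intro j hj
    simp_rw [hF, etaFactors_of_ne_apply (Finset.ne_of_mem_erase hj)]
    exact integral_sq_slabFactor_complex hL hσ0.le hσ1
  rw [Finset.prod_congr rfl hones, Finset.prod_const_one, mul_one]
  -- the one-body integral
  have hh1 : ∀ y : Space, h y = pairingFun L σ (y 0) := by
    intro y
    rw [hh, hF, etaFactors_zero]
    simp only [pairingFun, wave_e0, axisFun, slabFactor]
    rw [mul_comm (Complex.I) _]
    push_cast
    ring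
  simp_rw [hh1]
  have key := integral_cell_comp_coord0 hL.le (pairingFun L σ)
  rw [key, setIntegral_Ico_eq_intervalIntegral hL.le]

/-- **Lower bound on the pairing**: `‖∫ q η‖ ≥ 1/16`. [folklore] -/
theorem norm_pairing_ge (hL : 0 < L) (hσ0 : 0 < σ) (hσ : σ ≤ 1 / 3) :
    (1 : ℝ) / 16 ≤
      ‖∫ X in cellN (m + 1) L, fibreCharge L e0 (realProd m (slabFactor L σ)) X * eta m L σ X‖ := by
  have hσ1 : σ ≤ 1 := hσ.trans (by norm_num)
  have hZ := slabZ_pos hL hσ0.le hσ1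
  have hZb := (slabZ_bounds hL hσ0.le hσ1).2
  have hL3 : 0 < L ^ 3 := by positivity
  rw [pairing_eq hL hσ0 hσ1, norm_mul, norm_mul, norm_inv, Complex.norm_real,
    Real.norm_of_nonneg (Real.sqrt_nonneg _), norm_pow, Complex.norm_real, Real.norm_of_nonneg hL.le]
  have h1 := norm_intervalIntegral_pairingFun_ge hL hσ0 hσ
  have hsq : Real.sqrt (slabZ L σ) ≤ Real.sqrt (L ^ 3) := Real.sqrt_le_sqrt hZb
  have hs3 : 0 < Real.sqrt (L ^ 3) := Real.sqrt_pos.2 hL3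
  have h2 : L / 16 / Real.sqrt (L ^ 3) ≤ ‖∫ t in (0 : ℝ)..L, pairingFun L σ t‖ :=
    le_trans (by gcongr) h1
  have hL3ne : L ^ 3 ≠ 0 := hL3.ne'
  have hinv : (Real.sqrt (L ^ 3))⁻¹ * (Real.sqrt (L ^ 3))⁻¹ = (L ^ 3)⁻¹ := by
    rw [← mul_inv, Real.mul_self_sqrt hL3.le]
  calc (1 : ℝ) / 16 = (L ^ 3 / 16) * (L ^ 3)⁻¹ := by field_simp
    _ = (L ^ 3 / 16) * ((Real.sqrt (L ^ 3))⁻¹ * (Real.sqrt (L ^ 3))⁻¹) := by rw [hinv]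
    _ = (Real.sqrt (L ^ 3))⁻¹ * (L ^ 2 * (L / 16 / Real.sqrt (L ^ 3))) := by ring
    _ ≤ (Real.sqrt (L ^ 3))⁻¹ * (L ^ 2 * ‖∫ t in (0 : ℝ)..L, pairingFun L σ t‖) := by gcongr

end Main

end Summit.AtomisticToContinuum.BoseEinsteinCondensation.Theorems.FibreConductance.Negative

end
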